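import Mathlib.AlgebraicGeometry.Pullbacks
import Mathlib.AlgebraicGeometry.PullbackCarrier
import Mathlib.AlgebraicGeometry.Stalk
import HarnessLib

/-!
# `WildQuotients.SummitReduction` (stmt-ResolutionOfSingularities-16324), line `FramePerfect`:
# the affine chart `Spec (Γ(X,U) ⊗_{Γ(Y,V)} Γ(Y',V')) → X ×_Y Y'` and the stalks along it — scheme lemmas for stub `stub_pair_quasiSplitBaseChange`

Route `ResolutionOfSingularities/WildQuotients`, crux `SummitReduction`; third helper file of stub
`stub_pair_quasiSplitBaseChange` (quasi-splitness of a semi-stable curve is stable under base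
change; de Jong 1997, 5.7 and p. 614–615: "a rational singular point with rational tangents stays
so") of the line skeleton `Cruxes/SummitReduction/Lines/FramePerfect.lean` (v8). This is the
scheme-to-algebra transfer (SCH) of the stub: the local ring of `X ×_Y Y'` at a point `x'` is a
localisation of `Γ(X, U) ⊗_{Γ(Y, V)} Γ(Y', V')` for affine opens `U ∋ pr₁ x'`, `V' ∋ pr₂ x'` over an
affine open `V ⊆ Y`, COMPATIBLY with the stalk maps of the two projections; and the local rings of
`X`, `Y'` are localisations of `Γ(X, U)`, `Γ(Y', V')`. Hypothesis-free, Mathlib only: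

* `germ_stalkMap_stalkMap_eq_germ_of_comp_eq` — **stalk maps of a chart `χ : Spec S → P` are
  computed on sections**: if `χ ≫ p = Spec ι ≫ (Spec Γ(Z, W) → Z)` then
  `germ_W ≫ p^♯ ≫ χ^♯_t = ι ≫ (S → 𝒪_{Spec S, t})` (faithfulness of `Spec` and the canonical
  morphisms `Spec 𝒪_{Z,z} → Z`: Mathlib's `Scheme.SpecMap_stalkMap_fromSpecStalk`), with
  `isLocalization_stalk_Spec_germ`, `isLocalization_stalk_of_isIso_stalkMap` (`𝒪_{P, χ t} = S_t`
  when `χ^♯_t` is invertible) and their fraction forms `exists_mul_eq_of_isIso_stalkMap`,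
  `exists_isUnit_mul_mem_of_isIso_stalkMap`;
* `exists_germ_mul_eq_germ`, `maximalIdeal_le_map_comap_germ`, `germ_appLE_apply`,
  `stalkCongr_germ_apply` — stalks of `X` as localisations of `Γ(X, U)` (Mathlib's
  `IsAffineOpen.isLocalization_stalk`) and the compatibility of germs with `f.appLE`;
* `exists_affineChart_pullback` (entry theorem) — **the open immersion
  `χ : Spec (Γ(X,U) ⊗ Γ(Y',V')) → X ×_Y Y'` through `x'`** (Mathlib's `pullbackSpecIso` and
  `pullback.map` of the three open immersions `Spec Γ(-, -) → -`), with its two projections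
  `χ ≫ pr₁ = Spec (c ↦ c ⊗ 1) ≫ (Spec Γ(X,U) → X)`, `χ ≫ pr₂ = Spec (a' ↦ 1 ⊗ a') ≫ (Spec Γ(Y',V') → Y')`.
-/

set_option linter.dupNamespace false

noncomputable section

open CategoryTheory CategoryTheory.Limits AlgebraicGeometry TopologicalSpace TensorProduct

namespace Summit.ResolutionOfSingularities.ResolutionOfSingularities.Theorems

universe u

/-! ## Stalk maps of a chart through `Spec` of sections -/

section StalkOfChart

variable {Z P : Scheme.{u}} {S : CommRingCat.{u}} (χ : Spec S ⟶ P) (p : P ⟶ Z) {W : Z.Opens}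
  (hW : IsAffineOpen W) (ι : Γ(Z, W) ⟶ S)

/-- **Stalk maps of a chart are computed on sections.** If `χ : Spec S → P` and `p : P → Z`
satisfy `χ ≫ p = Spec ι ≫ (Spec Γ(Z, W) → Z)` for an affine open `W ⊆ Z` and a ring map
`ι : Γ(Z, W) → S`, then for every `t ∈ Spec S` the composite
`Γ(Z, W) → 𝒪_{Z, p(χ t)} → 𝒪_{P, χ t} → 𝒪_{Spec S, t}` of the germ map with the two stalk maps is
`Γ(Z, W) → S = Γ(Spec S) → 𝒪_{Spec S, t}` (both have the same `Spec` after composing with the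
monomorphism `Spec Γ(Z, W) → Z`: Mathlib's `Scheme.SpecMap_stalkMap_fromSpecStalk` twice).
[folklore] -/
theorem germ_stalkMap_stalkMap_eq_germ_of_comp_eq (hχ : χ ≫ p = Spec.map ι ≫ hW.fromSpec)
    (t : Spec S) (ht : p (χ t) ∈ W) :
    Z.presheaf.germ W (p (χ t)) ht ≫ p.stalkMap (χ t) ≫ χ.stalkMap t =
      ι ≫ (Scheme.ΓSpecIso S).inv ≫ (Spec S).presheaf.germ ⊤ t trivial := by
  apply Spec.map_injective
  rw [← cancel_mono hW.fromSpec]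
  simp only [Spec.map_comp, Category.assoc]
  have e1 : Spec.map (Z.presheaf.germ W (p (χ t)) ht) ≫ hW.fromSpec = Z.fromSpecStalk (p (χ t)) := by
    rw [← hW.fromSpecStalk_eq_fromSpecStalk ht]
    rfl
  rw [e1, Scheme.SpecMap_stalkMap_fromSpecStalk, Scheme.SpecMap_stalkMap_fromSpecStalk_assoc, hχ,
    Spec.fromSpecStalk_eq, Spec.map_comp, Category.assoc]

/-- Elementwise form of `germ_stalkMap_stalkMap_eq_germ_of_comp_eq`. [folklore] -/
theorem stalkMap_stalkMap_germ_eq_germ_of_comp_eq (hχ : χ ≫ p = Spec.map ι ≫ hW.fromSpec)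
    (t : Spec S) (ht : p (χ t) ∈ W) (s : Γ(Z, W)) :
    (χ.stalkMap t).hom ((p.stalkMap (χ t)).hom ((Z.presheaf.germ W (p (χ t)) ht).hom s)) =
      ((Spec S).presheaf.germ ⊤ t trivial).hom ((Scheme.ΓSpecIso S).inv.hom (ι.hom s)) := by
  have h := germ_stalkMap_stalkMap_eq_germ_of_comp_eq χ p hW ι hχ t ht
  have h' := congrArg (fun φ => φ.hom s) h
  simp only [CommRingCat.hom_comp, RingHom.coe_comp, Function.comp_apply] at h'
  exact h'

/-- **The stalk of `Spec S` at `t` is the localisation `S_t`** for the algebra structure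
`S = Γ(Spec S) → 𝒪_{Spec S, t}` written through `Scheme.ΓSpecIso` (Mathlib's
`StructureSheaf.IsLocalization.to_stalk`, restated on the scheme side of the abstraction boundary).
[folklore] -/
theorem isLocalization_stalk_Spec_germ (t : Spec S) :
    letI := (((Scheme.ΓSpecIso S).inv ≫ (Spec S).presheaf.germ ⊤ t trivial).hom).toAlgebra
    IsLocalization.AtPrime ((Spec S).presheaf.stalk t) t.asIdeal := by
  have h : (Scheme.ΓSpecIso S).inv ≫ (Spec S).presheaf.germ ⊤ t trivial = StructureSheaf.toStalk S t :=
    Spec.map_injective ((Spec.fromSpecStalk_eq S t).symm.trans (Spec.fromSpecStalk_eq' S t))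
  rw [h]
  exact StructureSheaf.IsLocalization.to_stalk S t

/-- The image point lies in `W`. [folklore] -/
theorem apply_apply_mem_of_comp_eq (hχ : χ ≫ p = Spec.map ι ≫ hW.fromSpec) (t : Spec S) :
    p (χ t) ∈ W := by
  rw [← Scheme.Hom.comp_apply, hχ, Scheme.Hom.comp_apply]
  have : hW.fromSpec (Spec.map ι t) ∈ Set.range hW.fromSpec := ⟨_, rfl⟩
  rwa [hW.range_fromSpec] at this

end StalkOfChart

/-! ## Localisation bookkeeping: stalks as localisations of sections -/

section Loc

variable {S L : Type u} [CommRing S] [CommRing L] [Algebra S L] (M : Submonoid S) [IsLocalization M L]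

include M in
/-- Every element of a localisation is a fraction `s/u` with `u` mapping to a unit. [folklore] -/
theorem exists_mul_eq_of_isLocalization' (l : L) :
    ∃ s u : S, IsUnit (algebraMap S L u) ∧ l * algebraMap S L u = algebraMap S L s := by
  obtain ⟨⟨s, u⟩, h⟩ := IsLocalization.surj M l
  exact ⟨s, u, IsLocalization.map_units L u, h⟩

include M in
/-- In a localisation, `s/1 ∈ I·L` forces `u s ∈ I` for some `u` mapping to a unit. [folklore] -/
theorem exists_isUnit_mul_mem_of_mem_map (I : Ideal S) (s : S)
    (hs : algebraMap S L s ∈ I.map (algebraMap S L)) :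
    ∃ u : S, IsUnit (algebraMap S L u) ∧ u * s ∈ I := by
  obtain ⟨⟨⟨i, hi⟩, m⟩, h⟩ := (IsLocalization.mem_map_algebraMap_iff M L).mp hs
  simp only at h
  have h' : algebraMap S L (s * m) = algebraMap S L i := by rw [map_mul, h]
  obtain ⟨c, hc⟩ := (IsLocalization.eq_iff_exists M L).mp h'
  refine ⟨c * m, ?_, ?_⟩
  · rw [map_mul]
    exact (IsLocalization.map_units L c).mul (IsLocalization.map_units L m)
  · have : ↑c * ↑m * s = ↑c * i := by rw [mul_assoc, mul_comm (↑m : S) s, hc]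
    rw [this]
    exact I.mul_mem_left _ hi

end Loc

section StalkOfSections

variable {X Y : Scheme.{u}} (f : X ⟶ Y) {U : X.Opens} (hU : IsAffineOpen U)

include hU in
/-- **Elements of `𝒪_{X,x}` are fractions of sections over an affine open `U ∋ x`** (Mathlib's
`IsAffineOpen.isLocalization_stalk`, in the form used here). [folklore] -/
theorem exists_germ_mul_eq_germ {x : X} (hx : x ∈ U) (o : X.presheaf.stalk x) :
    ∃ c₁ c₂ : Γ(X, U), IsUnit ((X.presheaf.germ U x hx).hom c₂) ∧
      o * (X.presheaf.germ U x hx).hom c₂ = (X.presheaf.germ U x hx).hom c₁ := by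
  letI : Algebra Γ(X, U) (X.presheaf.stalk x) := (X.presheaf.germ U x hx).hom.toAlgebra
  haveI : IsLocalization.AtPrime (X.presheaf.stalk x : Type u) (hU.primeIdealOf ⟨x, hx⟩).asIdeal :=
    hU.isLocalization_stalk ⟨x, hx⟩
  exact exists_mul_eq_of_isLocalization' (hU.primeIdealOf ⟨x, hx⟩).asIdeal.primeCompl o

include hU in
/-- **`𝔪_x` is the extension of its contraction to `Γ(X, U)`** for an affine open `U ∋ x` (the stalk
is the localisation at the prime of `x`). [folklore] -/
theorem maximalIdeal_le_map_comap_germ {x : X} (hx : x ∈ U) :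
    IsLocalRing.maximalIdeal (X.presheaf.stalk x) ≤
      ((IsLocalRing.maximalIdeal (X.presheaf.stalk x)).comap (X.presheaf.germ U x hx).hom).map
        (X.presheaf.germ U x hx).hom := by
  letI : Algebra Γ(X, U) (X.presheaf.stalk x) := (X.presheaf.germ U x hx).hom.toAlgebra
  haveI : IsLocalization.AtPrime (X.presheaf.stalk x : Type u) (hU.primeIdealOf ⟨x, hx⟩).asIdeal :=
    hU.isLocalization_stalk ⟨x, hx⟩
  have hu := IsLocalization.AtPrime.under_maximalIdeal (X.presheaf.stalk x : Type u)
    (hU.primeIdealOf ⟨x, hx⟩).asIdeal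
  have hm := IsLocalization.AtPrime.map_eq_maximalIdeal (hU.primeIdealOf ⟨x, hx⟩).asIdeal
    (X.presheaf.stalk x : Type u)
  rw [Ideal.under_def] at hu
  have h : Ideal.map (algebraMap Γ(X, U) (X.presheaf.stalk x))
      (Ideal.comap (algebraMap Γ(X, U) (X.presheaf.stalk x))
      (IsLocalRing.maximalIdeal (X.presheaf.stalk x))) = IsLocalRing.maximalIdeal (X.presheaf.stalk x) := by
    rw [hu, hm]
  exact le_of_eq h.symm

/-- **Germs commute with restriction maps of a morphism**: for affine (or any) opens
`U ⊆ f⁻¹ V`, `germ_x (f^*|_U^V a) = f^♯_x (germ_{f x} a)`. [folklore] -/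
theorem germ_appLE_apply {V : Y.Opens} {U : X.Opens} (hUV : U ≤ f ⁻¹ᵁ V) {x : X} (hx : x ∈ U)
    (a : Γ(Y, V)) :
    (X.presheaf.germ U x hx).hom ((f.appLE V U hUV).hom a) =
      (f.stalkMap x).hom ((Y.presheaf.germ V (f x) (hUV hx)).hom a) := by
  rw [← CommRingCat.comp_apply, ← CommRingCat.comp_apply, Scheme.Hom.germ_stalkMap, Scheme.Hom.appLE,
    Category.assoc, X.presheaf.germ_res]

/-- Germs are compatible with the identification of the stalks at equal points. [folklore] -/
theorem stalkCongr_germ_apply {V : Y.Opens} {y₁ y₂ : Y} (h : y₁ = y₂) (hy : y₁ ∈ V) (a : Γ(Y, V)) :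
    (Y.presheaf.stalkCongr (.of_eq h)).hom.hom ((Y.presheaf.germ V y₁ hy).hom a) =
      (Y.presheaf.germ V y₂ (h ▸ hy)).hom a := by
  subst h
  rw [← CommRingCat.comp_apply, TopCat.Presheaf.stalkCongr_hom, TopCat.Presheaf.germ_stalkSpecializes]

end StalkOfSections

section StalkOfSpec

variable {P : Scheme.{u}} {S : CommRingCat.{u}} (χ : Spec S ⟶ P) (t : Spec S) [IsIso (χ.stalkMap t)]

/-- **`𝒪_{P, χ t}` is the localisation `S_t`** when `χ : Spec S → P` is an isomorphism on the stalk
at `t` (e.g. an open immersion), for the algebra structure `S → 𝒪_{Spec S,t} ≅ 𝒪_{P, χ t}`.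
[folklore] -/
theorem isLocalization_stalk_of_isIso_stalkMap :
    letI := ((inv (χ.stalkMap t)).hom.comp
      ((Scheme.ΓSpecIso S).inv ≫ (Spec S).presheaf.germ ⊤ t trivial).hom).toAlgebra
    IsLocalization.AtPrime (P.presheaf.stalk (χ t)) t.asIdeal := by
  letI algSt : Algebra S ((Spec S).presheaf.stalk t) :=
    (((Scheme.ΓSpecIso S).inv ≫ (Spec S).presheaf.germ ⊤ t trivial).hom).toAlgebra
  haveI : IsLocalization.AtPrime ((Spec S).presheaf.stalk t) t.asIdeal := isLocalization_stalk_Spec_germ t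
  letI := ((inv (χ.stalkMap t)).hom.comp
      ((Scheme.ΓSpecIso S).inv ≫ (Spec S).presheaf.germ ⊤ t trivial).hom).toAlgebra
  let ε : ((Spec S).presheaf.stalk t) ≃ₐ[S] P.presheaf.stalk (χ t) :=
    AlgEquiv.ofRingEquiv (f := (asIso (χ.stalkMap t)).symm.commRingCatIsoToRingEquiv) (fun x => rfl)
  exact IsLocalization.isLocalization_of_algEquiv t.asIdeal.primeCompl ε

/-- Elements of `𝒪_{P, χ t}` are fractions `s/u` of elements of `S` with `u` mapping to a unit.
[folklore] -/
theorem exists_mul_eq_of_isIso_stalkMap (o : P.presheaf.stalk (χ t)) :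
    ∃ s u : S, IsUnit ((inv (χ.stalkMap t)).hom (((Scheme.ΓSpecIso S).inv ≫
        (Spec S).presheaf.germ ⊤ t trivial).hom u)) ∧
      o * (inv (χ.stalkMap t)).hom (((Scheme.ΓSpecIso S).inv ≫ (Spec S).presheaf.germ ⊤ t trivial).hom u) =
        (inv (χ.stalkMap t)).hom (((Scheme.ΓSpecIso S).inv ≫ (Spec S).presheaf.germ ⊤ t trivial).hom s) := by
  letI := ((inv (χ.stalkMap t)).hom.comp
      ((Scheme.ΓSpecIso S).inv ≫ (Spec S).presheaf.germ ⊤ t trivial).hom).toAlgebra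
  haveI := isLocalization_stalk_of_isIso_stalkMap χ t
  exact exists_mul_eq_of_isLocalization' t.asIdeal.primeCompl o

/-- In `𝒪_{P, χ t} = S_t`: `s/1 ∈ I 𝒪_{P, χ t}` forces `u s ∈ I` for some `u` mapping to a unit.
[folklore] -/
theorem exists_isUnit_mul_mem_of_isIso_stalkMap (I : Ideal S) (s : S)
    (hs : (inv (χ.stalkMap t)).hom (((Scheme.ΓSpecIso S).inv ≫ (Spec S).presheaf.germ ⊤ t trivial).hom s) ∈
      I.map ((inv (χ.stalkMap t)).hom.comp
        ((Scheme.ΓSpecIso S).inv ≫ (Spec S).presheaf.germ ⊤ t trivial).hom)) :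
    ∃ u : S, IsUnit ((inv (χ.stalkMap t)).hom (((Scheme.ΓSpecIso S).inv ≫
        (Spec S).presheaf.germ ⊤ t trivial).hom u)) ∧ u * s ∈ I := by
  letI := ((inv (χ.stalkMap t)).hom.comp
      ((Scheme.ΓSpecIso S).inv ≫ (Spec S).presheaf.germ ⊤ t trivial).hom).toAlgebra
  haveI := isLocalization_stalk_of_isIso_stalkMap χ t
  exact exists_isUnit_mul_mem_of_mem_map t.asIdeal.primeCompl I s hs

/-- The inverse stalk map undoes the stalk map. [folklore] -/
theorem inv_stalkMap_apply (z : P.presheaf.stalk (χ t)) :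
    (inv (χ.stalkMap t)).hom ((χ.stalkMap t).hom z) = z := by
  rw [← CommRingCat.comp_apply, IsIso.hom_inv_id, CommRingCat.id_apply]

end StalkOfSpec

/-! ## The affine chart of `X ×_Y Y'` through a point -/

section Chart

/-- **The affine chart `Spec (Γ(X,U) ⊗_{Γ(Y,V)} Γ(Y',V')) → X ×_Y Y'` through a point** `x'` with
`pr₁ x' ∈ U`, `pr₂ x' ∈ V'` (affine opens over an affine open `V ⊆ Y`, the algebra structures on
the sections being the restriction maps of `f` and `ψ`): an open immersion (Mathlib's
`pullbackSpecIso` followed by `pullback.map` of the open immersions `Spec Γ(X,U) → X`,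
`Spec Γ(Y',V') → Y'` over `Spec Γ(Y,V) → Y`) whose composites with the two projections are
`Spec (c ↦ c ⊗ 1) ≫ (Spec Γ(X,U) → X)` and `Spec (a' ↦ 1 ⊗ a') ≫ (Spec Γ(Y',V') → Y')`.
[cite: StacksProject, Tag 01JO] -/
theorem exists_affineChart_pullback {X Y Y' : Scheme.{u}} (f : X ⟶ Y) (ψ : Y' ⟶ Y) {V : Y.Opens}
    (hV : IsAffineOpen V) {U : X.Opens} (hU : IsAffineOpen U) (hUV : U ≤ f ⁻¹ᵁ V) {V' : Y'.Opens}
    (hV' : IsAffineOpen V') (hV'V : V' ≤ ψ ⁻¹ᵁ V) [Algebra Γ(Y, V) Γ(X, U)] [Algebra Γ(Y, V) Γ(Y', V')]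
    (hC : algebraMap Γ(Y, V) Γ(X, U) = (f.appLE V U hUV).hom)
    (hA' : algebraMap Γ(Y, V) Γ(Y', V') = (ψ.appLE V V' hV'V).hom)
    (x' : ↥(pullback f ψ)) (hx : pullback.fst f ψ x' ∈ U) (hy' : pullback.snd f ψ x' ∈ V') :
    ∃ (χ : Spec (.of (Γ(X, U) ⊗[Γ(Y, V)] Γ(Y', V'))) ⟶ pullback f ψ) (t : _),
      IsOpenImmersion χ ∧ χ t = x' ∧
      χ ≫ pullback.fst f ψ = Spec.map (CommRingCat.ofHom
        (Algebra.TensorProduct.includeLeftRingHom : Γ(X, U) →+* Γ(X, U) ⊗[Γ(Y, V)] Γ(Y', V'))) ≫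
          hU.fromSpec ∧
      χ ≫ pullback.snd f ψ = Spec.map (CommRingCat.ofHom
        ((Algebra.TensorProduct.includeRight :
          Γ(Y', V') →ₐ[Γ(Y, V)] Γ(X, U) ⊗[Γ(Y, V)] Γ(Y', V'))).toRingHom) ≫ hV'.fromSpec := by
  have e₁ : Spec.map (CommRingCat.ofHom (algebraMap Γ(Y, V) Γ(X, U))) ≫ hV.fromSpec =
      hU.fromSpec ≫ f := by
    rw [hC, CommRingCat.ofHom_hom]
    exact IsAffineOpen.SpecMap_appLE_fromSpec f hV hU hUV
  have e₂ : Spec.map (CommRingCat.ofHom (algebraMap Γ(Y, V) Γ(Y', V'))) ≫ hV.fromSpec =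
      hV'.fromSpec ≫ ψ := by
    rw [hA', CommRingCat.ofHom_hom]
    exact IsAffineOpen.SpecMap_appLE_fromSpec ψ hV hV' hV'V
  let μ : pullback (Spec.map (CommRingCat.ofHom (algebraMap Γ(Y, V) Γ(X, U))))
      (Spec.map (CommRingCat.ofHom (algebraMap Γ(Y, V) Γ(Y', V')))) ⟶ pullback f ψ :=
    pullback.map _ _ f ψ hU.fromSpec hV'.fromSpec hV.fromSpec e₁ e₂
  let χ : Spec (.of (Γ(X, U) ⊗[Γ(Y, V)] Γ(Y', V'))) ⟶ pullback f ψ :=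
    (pullbackSpecIso Γ(Y, V) Γ(X, U) Γ(Y', V')).inv ≫ μ
  have hμ : IsOpenImmersion μ := Scheme.pullback_map_isOpenImmersion _ _ _ _ _ _ _ e₁ e₂
  have hχo : IsOpenImmersion χ := inferInstance
  have h1 : χ ≫ pullback.fst f ψ = Spec.map (CommRingCat.ofHom
      (Algebra.TensorProduct.includeLeftRingHom : Γ(X, U) →+* Γ(X, U) ⊗[Γ(Y, V)] Γ(Y', V'))) ≫
        hU.fromSpec := by
    simp only [χ, μ, Category.assoc, pullback.lift_fst, pullback.map]
    rw [pullbackSpecIso_inv_fst_assoc]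
  have h2 : χ ≫ pullback.snd f ψ = Spec.map (CommRingCat.ofHom
      ((Algebra.TensorProduct.includeRight :
        Γ(Y', V') →ₐ[Γ(Y, V)] Γ(X, U) ⊗[Γ(Y, V)] Γ(Y', V'))).toRingHom) ≫ hV'.fromSpec := by
    simp only [χ, μ, Category.assoc, pullback.lift_snd, pullback.map]
    rw [pullbackSpecIso_inv_snd_assoc]
    rfl
  -- the point: `x'` lies over `U` and `V'`, hence in the range of `μ`
  have hx' : x' ∈ Set.range μ := by
    rw [Scheme.Pullback.range_map, hU.range_fromSpec, hV'.range_fromSpec]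
    exact ⟨hx, hy'⟩
  obtain ⟨w, hw⟩ := hx'
  refine ⟨χ, (pullbackSpecIso Γ(Y, V) Γ(X, U) Γ(Y', V')).hom w, hχo, ?_, h1, h2⟩
  simp only [χ]
  rw [← Scheme.Hom.comp_apply, Iso.hom_inv_id_assoc]
  exact hw

end Chart

end Summit.ResolutionOfSingularities.ResolutionOfSingularities.Theorems

end
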